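import Literature.ModelTheory.PseudofiniteFields.EtaleOpenTopologyBasis
import Mathlib.Algebra.MvPolynomial.Equiv
import Mathlib.Algebra.MvPolynomial.PDeriv
import Mathlib.Algebra.Polynomial.Derivative

/-!
# The chart induction, Case 2: coordinate bookkeeping for the lifted chart
(line LonelyTranslates c1, Prop27Reduction; part of the proof of `stub_openPiece`)

The lifted chart adjoins the last coordinate of `K^{m+1}` as a new BOUND coordinate `w_0`
(old bound coordinates move to `Fin.succ`): the coordinate splitting `exists_liftSplit`, the
placement `Q ↦ Q(u, w_succ; w_0)` of a polynomial `Q ∈ K[u, w][t]` (`eval` and `∂/∂w_0` of the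
placed polynomial), and the triangularity of the lifted system.
-/

set_option linter.dupNamespace false

namespace Summit.MatrixMultiplication.MatrixMultiplication.Theorems.PairwiseCurvedTilingsLC.Negative

open Polynomial

section LiftBasics

variable {K : Type} {m e k : ℕ}

/-- The lifted coordinate splitting `Fin (m+1) ≃ Fin e ⊕ Fin (k+1)`: the last coordinate becomes
the bound coordinate `0`, a free coordinate stays, a bound coordinate `w_j` becomes `w_{j+1}`.
[folklore] -/
theorem exists_liftSplit (σ' : Fin m ≃ Fin e ⊕ Fin k) :
    ∃ σ : Fin (m + 1) ≃ Fin e ⊕ Fin (k + 1),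
      σ (Fin.last m) = Sum.inr 0 ∧
      (∀ i : Fin m, σ (Fin.castSucc i) = Sum.map id Fin.succ (σ' i)) ∧
      σ.symm (Sum.inr 0) = Fin.last m ∧
      (∀ u : Fin e, σ.symm (Sum.inl u) = Fin.castSucc (σ'.symm (Sum.inl u))) ∧
      (∀ j : Fin k, σ.symm (Sum.inr j.succ) = Fin.castSucc (σ'.symm (Sum.inr j))) := by
  refine ⟨{ toFun := Fin.lastCases (Sum.inr 0) (fun i => Sum.map id Fin.succ (σ' i))
            invFun := Sum.elim (fun u => Fin.castSucc (σ'.symm (Sum.inl u)))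
              (Fin.cases (Fin.last m) (fun j => Fin.castSucc (σ'.symm (Sum.inr j))))
            left_inv := fun i => ?_
            right_inv := fun s => ?_ }, ?_, fun i => ?_, rfl, fun u => rfl, fun j => rfl⟩
  · cases i using Fin.lastCases with
    | last => simp
    | cast i =>
      simp only [Fin.lastCases_castSucc]
      rcases h : σ' i with u | j
      · simp only [Sum.map_inl, id_eq, Sum.elim_inl]
        rw [← h, Equiv.symm_apply_apply]
      · simp only [Sum.map_inr, Sum.elim_inr, Fin.cases_succ]
        rw [← h, Equiv.symm_apply_apply]
  · rcases s with u | j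
    · simp
    · cases j using Fin.cases with
      | zero => simp
      | succ j => simp
  · simp [Equiv.coe_fn_mk]
  · simp

/-- Restricting a lifted point to the old chart coordinates. [folklore] -/
theorem comp_liftSplit_sumMap {σ' : Fin m ≃ Fin e ⊕ Fin k} {σ : Fin (m + 1) ≃ Fin e ⊕ Fin (k + 1)}
    (hl : ∀ u : Fin e, σ.symm (Sum.inl u) = Fin.castSucc (σ'.symm (Sum.inl u)))
    (hr : ∀ j : Fin k, σ.symm (Sum.inr j.succ) = Fin.castSucc (σ'.symm (Sum.inr j)))
    (x : Fin (m + 1) → K) :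
    (x ∘ σ.symm) ∘ Sum.map id Fin.succ = Fin.init x ∘ σ'.symm := by
  funext s
  rcases s with u | j
  · simp [hl, Fin.init]
  · simp [hr, Fin.init]

variable [Field K]

/-- Evaluating the placed polynomial `Q(u, w_succ; w_0)`. [folklore] -/
theorem eval_eval₂_rename_sumMap_succ (Q : Polynomial (MvPolynomial (Fin e ⊕ Fin k) K))
    (z : Fin e ⊕ Fin (k + 1) → K) :
    MvPolynomial.eval z (Q.eval₂ (MvPolynomial.rename
        (Sum.map id Fin.succ : Fin e ⊕ Fin k → Fin e ⊕ Fin (k + 1))).toRingHom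
          (MvPolynomial.X (Sum.inr 0))) =
      (Q.map (MvPolynomial.eval (z ∘ Sum.map id Fin.succ))).eval (z (Sum.inr 0)) := by
  rw [Polynomial.hom_eval₂, Polynomial.eval_map]
  congr 1
  · refine MvPolynomial.ringHom_ext (fun a => by simp) (fun i => ?_)
    simp
  · simp

/-- The `w_0`-derivative of the placed polynomial is the placed derivative. [folklore] -/
theorem pderiv_inr_zero_eval₂_rename_sumMap_succ (Q : Polynomial (MvPolynomial (Fin e ⊕ Fin k) K)) :
    MvPolynomial.pderiv (Sum.inr 0) (Q.eval₂ (MvPolynomial.rename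
        (Sum.map id Fin.succ : Fin e ⊕ Fin k → Fin e ⊕ Fin (k + 1))).toRingHom
          (MvPolynomial.X (Sum.inr 0))) =
      (derivative Q).eval₂ (MvPolynomial.rename
        (Sum.map id Fin.succ : Fin e ⊕ Fin k → Fin e ⊕ Fin (k + 1))).toRingHom
          (MvPolynomial.X (Sum.inr 0)) := by
  induction Q using Polynomial.induction_on' with
  | add p q hp hq => simp only [Polynomial.eval₂_add, map_add, hp, hq]
  | monomial n a =>
    simp only [Polynomial.eval₂_monomial, derivative_monomial, AlgHom.toRingHom_eq_coe,
      RingHom.coe_coe]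
    rw [(MvPolynomial.pderiv (Sum.inr 0)).leibniz, (MvPolynomial.pderiv (Sum.inr 0)).leibniz_pow]
    have h0 : MvPolynomial.pderiv (Sum.inr (0 : Fin (k + 1)))
        (MvPolynomial.rename (Sum.map id Fin.succ : Fin e ⊕ Fin k → Fin e ⊕ Fin (k + 1)) a) = 0 := by
      refine Literature.ModelTheory.PseudofiniteFields.EtaleDatum.pderiv_rename_eq_zero_of_forall_ne
        (fun s => ?_) a
      rcases s with u | j
      · simp
      · simp [Fin.succ_ne_zero]
    simp only [h0, MvPolynomial.pderiv_X_self, smul_eq_mul, mul_one, map_mul, map_natCast]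
    rcases n with _ | n
    · simp
    · simp only [Nat.add_sub_cancel, Nat.cast_add, Nat.cast_one]
      ring

/-- The lifted system `(Q(u, w_succ; w_0); D'_j(u, w_succ))` is triangular if `D'` is.
[folklore] -/
theorem liftChart_triangular (Q : Polynomial (MvPolynomial (Fin e ⊕ Fin k) K))
    (D' : Fin k → MvPolynomial (Fin e ⊕ Fin k) K)
    (htri' : ∀ j i : Fin k, i < j → MvPolynomial.pderiv (Sum.inr i) (D' j) = 0) :
    ∀ j i : Fin (k + 1), i < j → MvPolynomial.pderiv (Sum.inr i)
      ((Fin.cons (Q.eval₂ (MvPolynomial.rename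
          (Sum.map id Fin.succ : Fin e ⊕ Fin k → Fin e ⊕ Fin (k + 1))).toRingHom
            (MvPolynomial.X (Sum.inr 0)))
        (fun j => MvPolynomial.rename (Sum.map id Fin.succ : Fin e ⊕ Fin k → Fin e ⊕ Fin (k + 1))
          (D' j)) : Fin (k + 1) → MvPolynomial (Fin e ⊕ Fin (k + 1)) K) j) = 0 := by
  intro j i hij
  cases j using Fin.cases with
  | zero => exact absurd hij (Fin.not_lt_zero i)
  | succ j =>
    simp only [Fin.cons_succ]
    cases i using Fin.cases with
    | zero =>
      refine Literature.ModelTheory.PseudofiniteFields.EtaleDatum.pderiv_rename_eq_zero_of_forall_ne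
        (fun s => ?_) (D' j)
      rcases s with u | j'
      · simp
      · simp [Fin.succ_ne_zero]
    | succ i =>
      have hinj : Function.Injective (Sum.map id Fin.succ : Fin e ⊕ Fin k → Fin e ⊕ Fin (k + 1)) :=
        Sum.map_injective.2 ⟨Function.injective_id, Fin.succ_injective _⟩
      have := MvPolynomial.pderiv_rename hinj (Sum.inr i) (D' j)
      simp only [Sum.map_inr] at this
      rw [this, htri' j i (Fin.succ_lt_succ_iff.1 hij), map_zero]

/-- Evaluating the lifted old equations at a lifted point. [folklore] -/
theorem eval_rename_sumMap_succ (p : MvPolynomial (Fin e ⊕ Fin k) K) (z : Fin e ⊕ Fin (k + 1) → K) :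
    MvPolynomial.eval z (MvPolynomial.rename
      (Sum.map id Fin.succ : Fin e ⊕ Fin k → Fin e ⊕ Fin (k + 1)) p) =
      MvPolynomial.eval (z ∘ Sum.map id Fin.succ) p :=
  MvPolynomial.eval_rename _ _ _

/-- The `w_{j+1}`-derivative of a lifted old equation is the lifted `w_j`-derivative.
[folklore] -/
theorem pderiv_inr_succ_rename_sumMap_succ (p : MvPolynomial (Fin e ⊕ Fin k) K) (j : Fin k) :
    MvPolynomial.pderiv (Sum.inr j.succ) (MvPolynomial.rename
      (Sum.map id Fin.succ : Fin e ⊕ Fin k → Fin e ⊕ Fin (k + 1)) p) =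
      MvPolynomial.rename (Sum.map id Fin.succ : Fin e ⊕ Fin k → Fin e ⊕ Fin (k + 1))
        (MvPolynomial.pderiv (Sum.inr j) p) := by
  have hinj : Function.Injective (Sum.map id Fin.succ : Fin e ⊕ Fin k → Fin e ⊕ Fin (k + 1)) :=
    Sum.map_injective.2 ⟨Function.injective_id, Fin.succ_injective _⟩
  have := MvPolynomial.pderiv_rename hinj (Sum.inr j) p
  simpa only [Sum.map_inr] using this

end LiftBasics

end Summit.MatrixMultiplication.MatrixMultiplication.Theorems.PairwiseCurvedTilingsLC.Negative
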